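import Literature.MathematicalPhysics.QuantumFieldTheory.Balaban1983to89.B8Ineq130FaceRec
import Literature.MathematicalPhysics.QuantumFieldTheory.Balaban1983to89.B8PointwiseOscFromFineBondsRec
import Literature.MathematicalPhysics.QuantumFieldTheory.Balaban1983to89.B8BlockConstantLiftDentedRec

/-!
# `Balaban1983to89.B8CrownU0PointwiseOscOfFacesRec` — [Balaban1985RegularSpaces] (1.135) p. 99 ∕ [Balaban1985Averaging] (166)–(167) p. 44: THE POINTWISE MULTISCALE OSCILLATION OF
# THEOREM 4's GAUGE FUNCTION `u₀` UNDER A DENTED CELL, from the FACE-LEVEL bond letters of the hierarchical axial gauge `U₀″` (`B8Ineq130FaceRec`) by FACE COUNTING along the centre segments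

statement-level skeleton of published theorems with citation tags; proofs where landed; nothing here is a claim about the Yang–Mills mass gap

CITATION HEADER (lean-in-tree rule).  Cell `pub-ymgap` (HUMAN RULING D-0062), seat `pub-ymgap-dag-n07-w3` g14 ((σ1) PEN OF RECORD, director-ym №330; INTENT-33, cell bus 2026-08-30).
[6] = [Balaban1985RegularSpaces] Lemma 1 p. 79, (1.15) p. 78, (1.29) p. 81, (1.130)∕(1.133)∕(1.135) p. 99; [3] = [Balaban1985Averaging] (8) p. 18, (166)–(167) p. 44, (180)–(182) p. 46;
[15] = [Balaban1985Variational] (148)–(152) p. 301; [I] = [Balaban1987RG1] (0.3)–(0.4) pp. 252–253.  `--kind proof --supports stmt-QuantumFields-20541` (K0⁷; count-neutral; no definition).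
REUSED BY NAME: `B8Ineq130FaceRec.norm_cutFixedZ_sub_one_le_face` (the face-level (1.133), this seat), dag-n07-e's ✓`B8PointwiseOscFromFineBondsRec.{underZ_succ_segment,
adjacent_centre_letters_of_weightedFineBonds, norm_inv_mul_shift_sub_one_le_of_gaugeAct, inv_mul_eq_of_blockConstant}`, ✓`B8CentreOscDescentRec.pointwise_osc_of_adjacent_centres`,
dag-n05-e's ✓`B8BlockConstantLiftDentedRec.mem_sq_zero_of_underZ_lamS` and `Node00.CubeB8DZ` (`dprime ∕ fixed ∕ sq ∕ lamS`), dag-n05-d's `B8Eq119TwistedAxialRec.{UnderZ, flmZ, underZ_flmZ,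
underZ_iff_flmZ_eq}`, `B8Eq131CubesRec.{cube_subset_tcube, mem_cube_iff}`, `B8Ineq128Rec.gaugeFix_global`, `B8Ineq132Rec.pdevOn_lt_of_inAk_box`.

WHY (the (σ1) input `hptu` of the K0-road junction, ✓p759262 §4 ∕ ✓p760822 ∕ ✓p760315's `hJ`).  ✓`B8PointwiseOscFromFineBondsRec` turns FINE-BOND letters of `um := h⁻¹u₀` under a
cell into the pointwise multiscale oscillation `hptu`; bond by bond `‖um(x)⁻¹um(x + e_μ) − 1‖ ≤ ‖W(x,μ) − 1‖ + ‖F(x,μ) − 1‖` with `W := U₀″ = c.dprime V` (the cut hierarchical axial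
gauge, [6] p. 99) and `F := W^{um⁻¹} = c.fixed V um` (the exponential of the (1.38) log rows).  The letter of `W` is NOT uniform: `U₀″` jumps by `(9d² + 4ds)·α₀·(L^m∕L^k)²` across a
bond whose endpoints merge at level `m` (`B8Ineq130FaceRec`), i.e. by `O(α₀)` across the top faces.  Along the straight segment of `Lⁿ` fine bonds joining two adjacent level-`n`
centres inside one level-`(n+1)` block, exactly `L^{n−m}` bonds cross a level-`m` face (`m ≤ n`), so the segment sum is `≤ Σ_{m≤n} L^{n−m}·FB(m+1) ≤ (3∕2)(9d² + 4ds)α₀·L^{2n+2}∕L^{2k}`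
— GEOMETRIC in `n`, which is what ✓`B8CentreOscDescentRec.pointwise_osc_of_adjacent_centres` needs: `ω_u := 3ds(9d² + 4ds)·α₀ + 2ds·δ_F·L^{j−1}` UNIFORMLY in the cell level `j ≤ k`.

WHAT IS PROVED (sorry-free; axioms standard).
§1 (ℤᵈ bookkeeping) ★ `dvd_of_flmZ_ne` — a bond leaves its centred level-`m` block only through the block's last site: `flmZ L m x ≠ flmZ L m (x + e_μ) ⇒ Lᵐ ∣ x_μ + 1 + c_m`;
   ★ `card_filter_dvd_le` — among `q·P` consecutive shifts at most `q` are multiples of `P`; `mem_sq_of_underZ_lamS` — a fine site under a dented cell `y ∈ Λ′_j` lies in `Ω′_j`;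
   `inBox_tcube_of_underZ_lamS` — and in `□̃`.
§2 ★★ `norm_sub_one_le_faceSum` ∕ ★★★ `sum_segment_le_faceCount` — for ANY configuration `W` with face letters `FB(m)` on the bonds of a centre segment and a common level-`(n+1)`
   block: pointwise `‖W(b_t) − 1‖ ≤ Σ_{m≤n} [Lᵐ ∣ t + 1 + c_m]·FB(m+1)` and `Σ_{t<Lⁿ} ‖W(b_t) − 1‖ ≤ Σ_{m≤n} L^{n−m}·FB(m+1)`.
§3 ★ `faceCount_closed_form` — `Σ_{m≤n} L^{n−m}·(C·(L^{m+1})²·P) ≤ (3∕2)·C·P·(L^{n+1})²` (`L ≥ 3`).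
§4 ★★★ `sum_segment_dprime_le` — THE CARRIER READ at `W := c.dprime V` under a dented cell `y ∈ Λ′_j` (`1 ≤ j ≤ k`): for `z` under `y` at depth `j − (n+1)` and adjacent `a, a + e_μ`
   under `z`: `Σ_{t<Lⁿ} ‖c.dprime V (Lⁿa + t e_μ, μ) − 1‖ ≤ (3∕2)(9d² + 4ds)α₀·(L^{n+1})²·(L^k)^{−2}` from `V ∈ 𝔄_k` (`InAk … α₀ Ω V`, «□̃ ⊂ Ω_{k−1}» is the datum's field) and the
   record's Prop.-1∕(1.130) smallness; `cutFixedZ_mem_unitaryUnits` (`U₀″` unitary-valued).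
§5 ★★★ `pointwise_osc_of_faces_precomposed` — `hptu` FOR THE CROWN's `u₀` (`um := h⁻¹u₀` unitary under the cell, `h` block-constant under the cell, `‖c.fixed V (h⁻¹u₀)(b) − 1‖ ≤ δ_F`
   under the cell): `‖u₀(L^{i+1}z)⁻¹u₀(w) − 1‖ ≤ ω_u·(L⁻¹)^{j−(i+1)}`, `ω_u := 3ds(9d² + 4ds)·α₀ + 2ds·δ_F·L^{j−1}` — the `hptu` binder of ✓p759262 §4 ∕ ✓p760822 with `θ := L⁻¹`.
HONEST FRAMING: count-neutral helper (face counting ∕ centred-block arithmetic over the tree's own Lemma-1 descent); NO inequality of [6]∕[3]∕[15]∕[I] beyond Lemma 1's iteration asserted;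
`δ_F` (✓`B8CfgExpBondLetterRec` on the crown's log rows) stays DISPLAYED; `hJ` ∕ `DatumCrownPhiAt` inhabited by nobody; `HThm4RecSym152PhiEG` ∕ `HThm4Rec*` UNDISCHARGED; N05 ∕ N07 NOT
discharged; K0⁷ ∕ K1⁹ NOT closed; counts unmoved; one finite 𝕋⁴ programme at fixed ε — R4 closes the conditional finite-𝕋⁴ rung `BalabanLadder.UV` only; the YM mass gap (Clay) is NOT
proved by any of this; nothing continuum ∕ ℝ⁴ ∕ OS.  No `def`, no `instance`, no `notation`, no `sorry`.
-/

set_option autoImplicit false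

noncomputable section

open scoped BigOperators
open Finset

namespace Literature.MathematicalPhysics.QuantumFieldTheory.Balaban1983to89.B8CrownU0PointwiseOscOfFacesRec

open B7Prop1Explicit hiding Site
open B7Prop1Explicit renaming Site → SiteZ
open B7Prop1Local (InBox pdevOn)
open B7Prop2Explicit (c2' unitaryUnits unitaryUnits_le_U1)
open B7Prop2Rec (AvgClosedZ C0Z avgClosedZ_unitaryUnits)
open BlockAveragingZd (ctrShift two_mul_ctrShift_add_one)
open B8Ineq130 (aLev inBox_of_le)
open B8Ineq130Rec (tlo thi tlo_le_thi)
open B8Eq119TwistedAxialRec (UnderZ flmZ underZ_flmZ underZ_iff_flmZ_eq)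
open B8BlockConstantLiftStabilityRec (underZ_add underZ_pow_smul)
open B8Eq131Cubes (tLo tHi ctr ctr_mem tLo_le_tHi)
open B8Eq131CubesRec (cubeZ tcubeZ cube_subset_tcube mem_cube_iff)
open B8Ineq132 (InAk)
open B8Ineq132Rec (pdevOn_lt_of_inAk_box)
open B8Ineq133 (cutCfg_mem)
open B8Ineq133Rec (cutFixedZ)
open B8Eq115GaugeFixing (gaugeAct_mem_of)
open B8Eq115GaugeFixingRec (localGaugeZ)
open B8Ineq128Rec (gaugeFix_global)
open B7Prop1Local (clampCfg clampCfg_mem pdev_clampCfg_le)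
open B8Ineq130FaceRec (norm_cutFixedZ_sub_one_le_face)
open B8PointwiseOscFromFineBondsRec (underZ_succ_segment adjacent_centre_letters_of_weightedFineBonds norm_inv_mul_shift_sub_one_le_of_gaugeAct
  inv_mul_eq_of_blockConstant)
open B8CentreOscDescentRec (pointwise_osc_of_adjacent_centres)
open B8BlockConstantLiftDentedRec (mem_sq_zero_of_underZ_lamS)
open B8DentedCubeMemberZdRec (lamST_top_apply inBox_sq_of_mem_lamST)
open Node00 (CubeB8DZ)

variable {d : ℕ}

/-! ## §1  ℤᵈ bookkeeping: leaving a centred block, counting multiples, the tower under a dented cell -/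

/-- ★ **A BOND LEAVES ITS CENTRED LEVEL-`m` BLOCK ONLY THROUGH THE LAST SITE**: if `x` and `x + e_μ` have different centred `Lᵐ`-labels then `x_μ = Lᵐ·w_μ + c_m` for the label
`w` of `x`, hence `Lᵐ ∣ x_μ + 1 + c_m` (`2c_m + 1 = Lᵐ`, odd `L`). [cite: Balaban1987RG1, (0.3) p.252 (centred blocks; bookkeeping); Balaban1985RegularSpaces, (1.19) p.79] -/
theorem dvd_of_flmZ_ne {L : ℕ} (hL : Odd L) (m : ℕ) (x : SiteZ d) (μ : Fin d) (h : flmZ L m x ≠ flmZ L m (x + e μ)) :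
    ((L : ℤ) ^ m) ∣ (x μ + 1 + (ctrShift L m : ℤ)) := by
  have hx : UnderZ L m (flmZ L m x) x := underZ_flmZ hL m x
  have hc : 2 * (ctrShift L m : ℤ) + 1 = (L : ℤ) ^ m := by exact_mod_cast two_mul_ctrShift_add_one hL m
  by_contra hnd
  apply h
  symm
  rw [← underZ_iff_flmZ_eq hL]
  intro i
  obtain ⟨h1, h2⟩ := hx i
  by_cases hi : i = μ
  · subst hi
    simp only [Pi.add_apply, e_apply, if_true]
    refine ⟨by linarith, ?_⟩
    by_contra hgt
    have hgt' := not_le.mp hgt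
    have heq : x i - (L : ℤ) ^ m * flmZ L m x i = ctrShift L m := by linarith
    exact hnd ⟨flmZ L m x i + 1, by linarith⟩
  · simp only [Pi.add_apply, e_apply, if_neg hi, add_zero]
    exact ⟨h1, h2⟩

/-- ★ **AMONG `q·P` CONSECUTIVE SHIFTS AT MOST `q` ARE MULTIPLES OF `P`**: `#{t < q·P : P ∣ t + c} ≤ q` (the map `t ↦ t ∕ P` is injective on the multiples).
[cite: Balaban1987RG1, (0.3) p.252 (bookkeeping: the sites of a block row)] -/
theorem card_filter_dvd_le (P c q : ℕ) :
    ((Finset.range (q * P)).filter (fun t => P ∣ t + c)).card ≤ q := by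
  calc ((Finset.range (q * P)).filter (fun t => P ∣ t + c)).card
      ≤ (Finset.range q).card := by
        refine Finset.card_le_card_of_injOn (fun t => t / P) (fun t ht => ?_) (fun t ht t' ht' htt => ?_)
        · rw [Finset.mem_coe, Finset.mem_filter, Finset.mem_range] at ht
          rw [Finset.mem_coe, Finset.mem_range]
          exact Nat.div_lt_of_lt_mul (by rw [mul_comm]; exact ht.1)
        · rw [Finset.mem_coe, Finset.mem_filter] at ht ht'
          have hmod : t % P = t' % P :=
            ((Nat.modEq_zero_iff_dvd.2 ht.2).trans (Nat.modEq_zero_iff_dvd.2 ht'.2).symm).add_right_cancel' c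
          have hdiv : t / P = t' / P := htt
          rw [← Nat.div_add_mod t P, ← Nat.div_add_mod t' P, hmod, hdiv]
    _ = q := Finset.card_range q

section Cells

variable {L K : ℕ} {Ω : ℕ → Set (SiteZ d)}

/-- **A fine site under a dented cell `y ∈ Λ′_j` (`j ≤ k`) lies in `Ω′_j`** — below the top «□_j is a sum of the big blocks» ([6] p. 98, `mem_cube_iff`); at the top the dented cell's
block lies in `□_k ∩ Ω_k` (`under_lamS_top_subset`). (The level-`j` sharpening of ✓`B8BlockConstantLiftDentedRec.mem_sq_zero_of_underZ_lamS`, read by the crown's log rows on the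
sides touching `Ω′_j`.) [cite: Balaban1985RegularSpaces, p.98, (1.131) p.99, (1.19) p.79; Balaban1985Variational, (148)–(150) p.301; Balaban1987RG1, (0.3) p.252] -/
theorem mem_sq_of_underZ_lamS (hL : Odd L) (c : CubeB8DZ d L K Ω) {j : ℕ} (hj : j ≤ c.k) {y x : SiteZ d} (hy : y ∈ c.lamS j)
    (hx : UnderZ L j y x) : x ∈ c.sq j := by
  rcases lt_or_eq_of_le hj with hlt | rfl
  · have hbox : InBox (B8Eq131CubesRec.sqLoZ L c.a c.ρ c.k j) (B8Eq131CubesRec.sqHiZ L c.a c.M c.ρ c.k j) y := by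
      have hy' : y ∈ c.lamST c.k j := by rw [lamST_top_apply c j]; exact hy
      exact inBox_sq_of_mem_lamST c hy'
    rw [c.sq_of_lt hlt]
    exact (mem_cube_iff hL).2 ⟨y, hbox, hx⟩
  · exact c.under_lamS_top_subset hL hy hx

/-- **… and in `□̃ = [tlo k, thi k]`** (`Ω′_j ⊆ Ω′₀ = □₀ ⊆ □̃`, odd `L ≥ 2`, `ρ ≥ 1`). [cite: Balaban1985RegularSpaces, p.98 («□₀ ⊂ □̃»); Balaban1985Variational, (144) p.300; Balaban1987RG1, (0.3) p.252] -/
theorem inBox_tcube_of_underZ_lamS (hL : Odd L) (hL2 : 2 ≤ L) (c : CubeB8DZ d L K Ω) {j : ℕ} (hj : j ≤ c.k) {y x : SiteZ d} (hy : y ∈ c.lamS j)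
    (hx : UnderZ L j y x) : InBox (tlo L (tLo c.a c.ρ) c.k) (thi L (tHi c.a c.M c.ρ) c.k) x := by
  have h0 : x ∈ c.sq 0 := mem_sq_zero_of_underZ_lamS hL c hj hy hx
  rw [c.sq_zero] at h0
  exact cube_subset_tcube hL hL2 (le_trans (le_trans (by norm_num) hL2) c.L_le_ρ) (Nat.zero_le _) h0

end Cells

/-! ## §2  Face counting along a centre segment, for ANY configuration with face letters -/

section FaceCount

variable {𝔹 : Type*} [NormedRing 𝔹]

/-- ★★ **THE POINTWISE FACE BOUND ON A CENTRE SEGMENT**: let `x_t := Lⁿa + t·e_μ` (`t < Lⁿ`) be the sites of a straight segment whose bonds `b_t = ⟨x_t, x_t + e_μ⟩` all lie inside ONE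
centred level-`(n+1)` block, and let `W` obey the face letters `‖W(b_t) − 1‖ ≤ FB(m)` whenever `b_t` lies inside one centred level-`m` block, `1 ≤ m ≤ n + 1` (`FB ≥ 0`); then
`‖W(b_t) − 1‖ ≤ Σ_{m ≤ n} [Lᵐ ∣ t + 1 + c_m]·FB(m+1)` — the bond's merge level `m⋆ + 1` is witnessed by the divisibility at level `m⋆` (`dvd_of_flmZ_ne`; `Lᵐ ∣ Lⁿa_μ`).
[cite: Balaban1985RegularSpaces, (1.135) p.99, Lemma 1 p.79; Balaban1985Averaging, (166)–(167) p.44; Balaban1987RG1, (0.3) p.252] -/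
theorem norm_sub_one_le_faceSum {L : ℕ} (hL : Odd L) (W : SiteZ d → Fin d → 𝔹ˣ) (n : ℕ) (a : SiteZ d) (μ : Fin d) (FB : ℕ → ℝ) (hFB : ∀ m, 0 ≤ FB m)
    (htop : ∀ t : ℕ, t < L ^ n → flmZ L (n + 1) (((L : ℤ) ^ n) • a + (t : ℤ) • e μ) = flmZ L (n + 1) (((L : ℤ) ^ n) • a + (t : ℤ) • e μ + e μ))
    (hface : ∀ m, 1 ≤ m → m ≤ n + 1 → ∀ t : ℕ, t < L ^ n →
      flmZ L m (((L : ℤ) ^ n) • a + (t : ℤ) • e μ) = flmZ L m (((L : ℤ) ^ n) • a + (t : ℤ) • e μ + e μ) →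
      ‖((W (((L : ℤ) ^ n) • a + (t : ℤ) • e μ) μ : 𝔹ˣ) : 𝔹) - 1‖ ≤ FB m)
    (t : ℕ) (ht : t < L ^ n) :
    ‖((W (((L : ℤ) ^ n) • a + (t : ℤ) • e μ) μ : 𝔹ˣ) : 𝔹) - 1‖ ≤
      ∑ m ∈ Finset.range (n + 1), (if L ^ m ∣ t + 1 + ctrShift L m then FB (m + 1) else 0) := by
  classical
  set x : SiteZ d := ((L : ℤ) ^ n) • a + (t : ℤ) • e μ with hx
  have hex : ∃ m, flmZ L (m + 1) x = flmZ L (m + 1) (x + e μ) := ⟨n, htop t ht⟩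
  set ms := Nat.find hex with hms
  have hms_spec : flmZ L (ms + 1) x = flmZ L (ms + 1) (x + e μ) := Nat.find_spec hex
  have hms_le : ms ≤ n := Nat.find_min' hex (htop t ht)
  have hW : ‖((W x μ : 𝔹ˣ) : 𝔹) - 1‖ ≤ FB (ms + 1) := hface (ms + 1) (by omega) (by omega) t ht hms_spec
  -- the `ms`-th indicator is on
  have hdvd : L ^ ms ∣ t + 1 + ctrShift L ms := by
    rcases Nat.eq_zero_or_pos ms with h0 | hpos
    · rw [h0, pow_zero]; exact one_dvd _
    · obtain ⟨m', hm'⟩ : ∃ m', ms = m' + 1 := ⟨ms - 1, by omega⟩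
      have hne : flmZ L ms x ≠ flmZ L ms (x + e μ) := by
        rw [hm']
        exact Nat.find_min hex (show m' < Nat.find hex by omega)
      have hz := dvd_of_flmZ_ne hL ms x μ hne
      -- `x_μ = Lⁿa_μ + t` and `L^{ms} ∣ Lⁿ`
      have hxμ : x μ = (L : ℤ) ^ n * a μ + t := by
        simp only [hx, Pi.add_apply, Pi.smul_apply, smul_eq_mul, e_apply, if_true, mul_one]
      rw [hxμ] at hz
      have hLn : ((L : ℤ) ^ ms) ∣ (L : ℤ) ^ n * a μ := Dvd.dvd.mul_right (pow_dvd_pow _ hms_le) _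
      have hz' : ((L : ℤ) ^ ms) ∣ ((t + 1 + ctrShift L ms : ℕ) : ℤ) := by
        have hsub := dvd_sub hz hLn
        have e1 : (L : ℤ) ^ n * a μ + t + 1 + (ctrShift L ms : ℤ) - (L : ℤ) ^ n * a μ = ((t + 1 + ctrShift L ms : ℕ) : ℤ) := by push_cast; ring
        rwa [e1] at hsub
      exact_mod_cast hz'
  calc ‖((W x μ : 𝔹ˣ) : 𝔹) - 1‖ ≤ FB (ms + 1) := hW
    _ = (if L ^ ms ∣ t + 1 + ctrShift L ms then FB (ms + 1) else 0) := by rw [if_pos hdvd]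
    _ ≤ ∑ m ∈ Finset.range (n + 1), (if L ^ m ∣ t + 1 + ctrShift L m then FB (m + 1) else 0) := by
        refine Finset.single_le_sum (f := fun m => if L ^ m ∣ t + 1 + ctrShift L m then FB (m + 1) else 0) (fun m _ => ?_)
          (Finset.mem_range.2 (by omega))
        split_ifs
        · exact hFB _
        · exact le_rfl

/-- ★★★ **FACE COUNTING ALONG A CENTRE SEGMENT**: under the hypotheses of `norm_sub_one_le_faceSum`, the segment sum obeys
`Σ_{t<Lⁿ} ‖W(b_t) − 1‖ ≤ Σ_{m≤n} L^{n−m}·FB(m+1)` — exactly `L^{n−m}` of the `Lⁿ` bonds cross a level-`m` face (`card_filter_dvd_le` at `Lⁿ = L^{n−m}·Lᵐ`).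
[cite: Balaban1985RegularSpaces, (1.135) p.99, Lemma 1 p.79, p.87 (proof of (1.65)); Balaban1985Averaging, (166)–(167) p.44, (180)–(182) p.46; Balaban1987RG1, (0.3) p.252] -/
theorem sum_segment_le_faceCount {L : ℕ} (hL : Odd L) (W : SiteZ d → Fin d → 𝔹ˣ) (n : ℕ) (a : SiteZ d) (μ : Fin d) (FB : ℕ → ℝ) (hFB : ∀ m, 0 ≤ FB m)
    (htop : ∀ t : ℕ, t < L ^ n → flmZ L (n + 1) (((L : ℤ) ^ n) • a + (t : ℤ) • e μ) = flmZ L (n + 1) (((L : ℤ) ^ n) • a + (t : ℤ) • e μ + e μ))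
    (hface : ∀ m, 1 ≤ m → m ≤ n + 1 → ∀ t : ℕ, t < L ^ n →
      flmZ L m (((L : ℤ) ^ n) • a + (t : ℤ) • e μ) = flmZ L m (((L : ℤ) ^ n) • a + (t : ℤ) • e μ + e μ) →
      ‖((W (((L : ℤ) ^ n) • a + (t : ℤ) • e μ) μ : 𝔹ˣ) : 𝔹) - 1‖ ≤ FB m) :
    ∑ t ∈ Finset.range (L ^ n), ‖((W (((L : ℤ) ^ n) • a + (t : ℤ) • e μ) μ : 𝔹ˣ) : 𝔹) - 1‖ ≤
      ∑ m ∈ Finset.range (n + 1), (L : ℝ) ^ (n - m) * FB (m + 1) := by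
  classical
  calc ∑ t ∈ Finset.range (L ^ n), ‖((W (((L : ℤ) ^ n) • a + (t : ℤ) • e μ) μ : 𝔹ˣ) : 𝔹) - 1‖
      ≤ ∑ t ∈ Finset.range (L ^ n), ∑ m ∈ Finset.range (n + 1), (if L ^ m ∣ t + 1 + ctrShift L m then FB (m + 1) else 0) :=
        Finset.sum_le_sum fun t ht => norm_sub_one_le_faceSum hL W n a μ FB hFB htop hface t (Finset.mem_range.1 ht)
    _ = ∑ m ∈ Finset.range (n + 1), ∑ t ∈ Finset.range (L ^ n), (if L ^ m ∣ t + 1 + ctrShift L m then FB (m + 1) else 0) := Finset.sum_comm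
    _ = ∑ m ∈ Finset.range (n + 1), (((Finset.range (L ^ n)).filter (fun t => L ^ m ∣ t + 1 + ctrShift L m)).card : ℝ) * FB (m + 1) := by
        refine Finset.sum_congr rfl fun m _ => ?_
        rw [Finset.sum_ite, Finset.sum_const_zero, add_zero, Finset.sum_const, nsmul_eq_mul]
    _ ≤ ∑ m ∈ Finset.range (n + 1), (L : ℝ) ^ (n - m) * FB (m + 1) := by
        refine Finset.sum_le_sum fun m hm => ?_
        have hmn : m ≤ n := by have := Finset.mem_range.1 hm; omega
        refine mul_le_mul_of_nonneg_right ?_ (hFB _)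
        have hsplit : L ^ n = L ^ (n - m) * L ^ m := by rw [← pow_add, Nat.sub_add_cancel hmn]
        have hcard := card_filter_dvd_le (L ^ m) (1 + ctrShift L m) (L ^ (n - m))
        rw [← hsplit] at hcard
        have hcard' : ((Finset.range (L ^ n)).filter (fun t => L ^ m ∣ t + 1 + ctrShift L m)).card ≤ L ^ (n - m) := by
          have heq : ((Finset.range (L ^ n)).filter (fun t => L ^ m ∣ t + 1 + ctrShift L m)) =
              ((Finset.range (L ^ n)).filter (fun t => L ^ m ∣ t + (1 + ctrShift L m))) := by
            refine Finset.filter_congr fun t _ => ?_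
            rw [add_assoc]
          rw [heq]; exact hcard
        exact_mod_cast hcard'

end FaceCount

/-! ## §3  The closed form of the face count for geometric face letters -/

/-- `2·Σ_{m ≤ n} Lᵐ ≤ 3·Lⁿ` for `L ≥ 3`. [folklore] -/
private theorem two_mul_geom_le {L : ℕ} (hL : 3 ≤ L) : ∀ n : ℕ, 2 * ∑ m ∈ Finset.range (n + 1), (L : ℝ) ^ m ≤ 3 * (L : ℝ) ^ n
  | 0 => by norm_num
  | n + 1 => by
    have ih := two_mul_geom_le hL n
    have hL3 : (3 : ℝ) ≤ L := by exact_mod_cast hL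
    have h0 : (0 : ℝ) ≤ (L : ℝ) ^ n := by positivity
    rw [Finset.sum_range_succ, mul_add, pow_succ]
    nlinarith [mul_le_mul_of_nonneg_left hL3 h0]

/-- ★ **THE CLOSED FORM OF THE FACE COUNT**: with geometric face letters `FB(m) = C·(Lᵐ)²·P` (`C, P ≥ 0`, `L ≥ 3`):
`Σ_{m ≤ n} L^{n−m}·FB(m+1) = C·P·L^{n+2}·Σ_{m≤n} Lᵐ ≤ (3∕2)·C·P·(L^{n+1})²`. [cite: Balaban1985RegularSpaces, p.87 (the geometric series of (1.65)), (1.130) p.99] -/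
theorem faceCount_closed_form {L : ℕ} (hL : 3 ≤ L) {C P : ℝ} (hC : 0 ≤ C) (hP : 0 ≤ P) (n : ℕ) :
    ∑ m ∈ Finset.range (n + 1), (L : ℝ) ^ (n - m) * (C * ((L : ℝ) ^ (m + 1)) ^ 2 * P) ≤ 3 / 2 * C * P * ((L : ℝ) ^ (n + 1)) ^ 2 := by
  have hterm : ∀ m ∈ Finset.range (n + 1), (L : ℝ) ^ (n - m) * (C * ((L : ℝ) ^ (m + 1)) ^ 2 * P) = (C * P * (L : ℝ) ^ (n + 2)) * (L : ℝ) ^ m := by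
    intro m hm
    have hmn : m ≤ n := by have := Finset.mem_range.1 hm; omega
    have hpow : (L : ℝ) ^ (n - m) * ((L : ℝ) ^ (m + 1)) ^ 2 = (L : ℝ) ^ (n + 2) * (L : ℝ) ^ m := by
      rw [← pow_mul, ← pow_add, ← pow_add]
      congr 1
      omega
    calc (L : ℝ) ^ (n - m) * (C * ((L : ℝ) ^ (m + 1)) ^ 2 * P) = C * P * ((L : ℝ) ^ (n - m) * ((L : ℝ) ^ (m + 1)) ^ 2) := by ring
      _ = (C * P * (L : ℝ) ^ (n + 2)) * (L : ℝ) ^ m := by rw [hpow]; ring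
  rw [Finset.sum_congr rfl hterm, ← Finset.mul_sum]
  have hg := two_mul_geom_le hL n
  have hc0 : 0 ≤ C * P * (L : ℝ) ^ (n + 2) := by positivity
  have hsq : ((L : ℝ) ^ (n + 1)) ^ 2 = (L : ℝ) ^ (n + 2) * (L : ℝ) ^ n := by ring
  rw [hsq]
  nlinarith [mul_le_mul_of_nonneg_left hg hc0]

/-! ## §4  The carrier read: `W := U₀″ = c.dprime V` under a dented cell -/

section Carrier

variable {𝔸 : Type*} [CStarAlgebra 𝔸] [Nontrivial 𝔸]
variable {L K : ℕ} {Ω : ℕ → Set (SiteZ d)}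

/-- **`U₀″ = cutFixedZ …` IS UNITARY-VALUED** whenever `U₀` is (the (1.15)-gauge `localGaugeZ` is unitary-valued: `B8Ineq128Rec.gaugeFix_global` on the clamp; the cut-off keeps `1`
outside). [cite: Balaban1985RegularSpaces, (1.132) p.99, p.98; Balaban1985Averaging, Prop. 2 p.26; Balaban1987RG1, (0.4) p.253] -/
theorem cutFixedZ_mem_unitaryUnits {s : ℕ} (hLs : L = 2 * s + 1) (hL : 2 ≤ L) (k : ℕ) (U : SiteZ d → Fin d → 𝔸ˣ) (hU : ∀ x κ, U x κ ∈ unitaryUnits 𝔸)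
    {α₀ : ℝ} (hα : 0 < α₀) (hα3 : C0Z d * (α₀ * (L : ℝ) ^ 2) ≤ 1 / 3) (hα2 : 2 * (α₀ * (L : ℝ) ^ 2) ≤ c2' d L)
    (lo hi : SiteZ d) (hlohi : lo ≤ hi) (h17 : pdevOn (tlo L lo k) (thi L hi k) U < α₀ * (L : ℝ) ^ 2 * (((L : ℝ) ^ k)⁻¹) ^ 2) (y : SiteZ d)
    (x : SiteZ d) (κ : Fin d) : cutFixedZ L lo hi U k y x κ ∈ unitaryUnits 𝔸 := by
  have hG := avgClosedZ_unitaryUnits (𝔸 := 𝔸) d L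
  have hUU : ∀ x κ, U x κ ∈ U1 𝔸 := fun x κ => hG.le_U1 (hU x κ)
  have hkk : ∀ i, tlo L lo k i ≤ thi L hi k i := tlo_le_thi L hlohi k
  have hUcG : ∀ x κ, clampCfg (tlo L lo k) (thi L hi k) U x κ ∈ unitaryUnits 𝔸 := clampCfg_mem hU
  have h17c : B7Prop2Explicit.pdev (clampCfg (tlo L lo k) (thi L hi k) U) < α₀ * (L : ℝ) ^ 2 * (((L : ℝ) ^ k)⁻¹) ^ 2 :=
    (pdev_clampCfg_le hkk hUU).trans_lt h17
  obtain ⟨huG, -, -, -, -, -⟩ := gaugeFix_global hLs hL hG k _ hUcG hα hα3 hα2 h17c y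
  exact cutCfg_mem (gaugeAct_mem_of hU huG) x κ

/-- ★★★ **THE CARRIER READ: THE CENTRE-SEGMENT SUMS OF `U₀″ = c.dprime V` UNDER A DENTED CELL ARE GEOMETRIC** — for a dented record cube `c` (odd `L = 2s+1 ≥ 3`, `d ≥ 1`), `V` unitary in
`𝔄_k({Ω_j}, α₀)` («□̃ ⊂ Ω_{k−1}» is `c.tcube_sub`), the record's Prop.-1 smallness and `11d²L²α₀ ≤ 1∕6`; a cell `y ∈ Λ′_j` (`1 ≤ j ≤ k`), `n < j`, a level-`(n+1)` point `z` under `y`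
(depth `j − (n+1)`) and adjacent `a, a + e_μ ∈ B(z)`: `Σ_{t<Lⁿ} ‖U₀″(Lⁿa + t·e_μ, μ) − 1‖ ≤ (3∕2)·(9d² + 4ds)·α₀·(L^{n+1})²·(L^k)^{−2}` — the face letters of `B8Ineq130FaceRec` counted
along the segment (every bond of it lies under `y`, hence in `□̃`, and inside the level-`(n+1)` block of `z`).
[cite: Balaban1985RegularSpaces, (1.133) p.99, (1.130) p.99, Lemma 1 p.79, (1.135) p.99; Balaban1985Averaging, (166)–(167) p.44; Balaban1985Variational, (148)–(150) p.301; Balaban1987RG1, (0.3)–(0.4) pp.252–253] -/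
theorem sum_segment_dprime_le {s : ℕ} (hLs : L = 2 * s + 1) (hs : 1 ≤ s) (hd : 1 ≤ d) (c : CubeB8DZ d L K Ω)
    (V : SiteZ d → Fin d → 𝔸ˣ) (hV : ∀ x κ, V x κ ∈ unitaryUnits 𝔸) {η α₀ : ℝ} (hα : 0 < α₀)
    (hα3 : C0Z d * (α₀ * (L : ℝ) ^ 2) ≤ 1 / 3) (hα2 : 2 * (α₀ * (L : ℝ) ^ 2) ≤ c2' d L) (hsmall : 11 * (d : ℝ) ^ 2 * (L : ℝ) ^ 2 * α₀ ≤ 1 / 6)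
    (hA : InAk L c.k η α₀ Ω V)
    {j : ℕ} (hjk : j ≤ c.k) {y : SiteZ d} (hy : y ∈ c.lamS j)
    {n : ℕ} (hn : n < j) {z : SiteZ d} (hz : UnderZ L (j - (n + 1)) y z) {a : SiteZ d} {μ : Fin d} (ha : UnderZ L 1 z a) (ha' : UnderZ L 1 z (a + e μ)) :
    ∑ t ∈ Finset.range (L ^ n), ‖((c.dprime V (((L : ℤ) ^ n) • a + (t : ℤ) • e μ) μ : 𝔸ˣ) : 𝔸) - 1‖ ≤
      3 / 2 * ((9 * (d : ℝ) ^ 2 + 4 * d * s) * α₀) * (((L : ℝ) ^ c.k)⁻¹) ^ 2 * ((L : ℝ) ^ (n + 1)) ^ 2 := by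
  have hL : Odd L := ⟨s, hLs⟩
  have h3L : 3 ≤ L := by omega
  have hL2 : 2 ≤ L := by omega
  have hL1 : 1 ≤ L := by omega
  have hM1 : 1 ≤ c.M := le_trans (le_trans hL1 c.L_le_ρ) c.ρ_le_M
  have hG := avgClosedZ_unitaryUnits (𝔸 := 𝔸) d L
  have hdepth : j - (n + 1) + (n + 1) = j := by omega
  -- the bonds of the segment: under `y` (depth `j`), hence in `□̃`; inside the level-`(n+1)` block of `z`
  have hseg : ∀ t : ℕ, t ≤ L ^ n → UnderZ L (n + 1) z (((L : ℤ) ^ n) • a + (t : ℤ) • e μ) := fun t ht => underZ_succ_segment hL ha ha' ht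
  have hsegy : ∀ t : ℕ, t ≤ L ^ n → UnderZ L j y (((L : ℤ) ^ n) • a + (t : ℤ) • e μ) := fun t ht => by
    have h := underZ_add hL hz (hseg t ht); rwa [hdepth] at h
  have hsucc : ∀ t : ℕ, ((L : ℤ) ^ n) • a + (t : ℤ) • e μ + e μ = ((L : ℤ) ^ n) • a + (((t + 1 : ℕ)) : ℤ) • e μ := fun t => by
    push_cast; rw [add_smul, one_smul, add_assoc]
  have htop : ∀ t : ℕ, t < L ^ n → flmZ L (n + 1) (((L : ℤ) ^ n) • a + (t : ℤ) • e μ) = flmZ L (n + 1) (((L : ℤ) ^ n) • a + (t : ℤ) • e μ + e μ) := by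
    intro t ht
    rw [(underZ_iff_flmZ_eq hL (n + 1) z _).1 (hseg t ht.le), hsucc, (underZ_iff_flmZ_eq hL (n + 1) z _).1 (hseg (t + 1) ht)]
  -- (1.7) on `□̃` from `V ∈ 𝔄_k` and «□̃ ⊂ Ω_{k−1}»
  have hΩ : ∃ l, l ≤ c.k ∧ c.k ≤ l + 1 ∧ ∀ x, InBox (tlo L (tLo c.a c.ρ) c.k) (thi L (tHi c.a c.M c.ρ) c.k) x → x ∈ Ω l :=
    ⟨c.k - 1, Nat.sub_le _ _, by omega, fun x hx => c.tcube_sub hx⟩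
  have h17 := pdevOn_lt_of_inAk_box hL1 hα hA hΩ
  -- the face letters of `U₀″` at the bonds of the segment
  have hface : ∀ m, 1 ≤ m → m ≤ n + 1 → ∀ t : ℕ, t < L ^ n →
      flmZ L m (((L : ℤ) ^ n) • a + (t : ℤ) • e μ) = flmZ L m (((L : ℤ) ^ n) • a + (t : ℤ) • e μ + e μ) →
      ‖((c.dprime V (((L : ℤ) ^ n) • a + (t : ℤ) • e μ) μ : 𝔸ˣ) : 𝔸) - 1‖ ≤ (9 * (d : ℝ) ^ 2 + 4 * d * s) * α₀ * (((L : ℝ) ^ m) ^ 2 * (((L : ℝ) ^ c.k)⁻¹) ^ 2) := by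
    intro m hm1 hmn t ht hfl
    obtain ⟨m₀, rfl⟩ : ∃ m₀, m = m₀ + 1 := ⟨m - 1, by omega⟩
    have hx := inBox_tcube_of_underZ_lamS hL hL2 c hjk hy (hsegy t ht.le)
    have hx' := inBox_tcube_of_underZ_lamS hL hL2 c hjk hy (hsegy (t + 1) ht)
    rw [← hsucc] at hx'
    exact norm_cutFixedZ_sub_one_le_face hLs hs hd hG c.k V hV hα hα3 hα2 (tLo c.a c.ρ) (tHi c.a c.M c.ρ) (tLo_le_tHi hM1) h17 hsmall (ctr c.a c.M)
      (show m₀ + 1 ≤ c.k by omega) _ μ (fun i => (hx i).1) (fun i => (hx' i).2) hfl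
  have hC : 0 ≤ (9 * (d : ℝ) ^ 2 + 4 * d * s) * α₀ := by positivity
  have hP : 0 ≤ (((L : ℝ) ^ c.k)⁻¹) ^ 2 := by positivity
  refine (sum_segment_le_faceCount hL (c.dprime V) n a μ (fun m => (9 * (d : ℝ) ^ 2 + 4 * d * s) * α₀ * (((L : ℝ) ^ m) ^ 2 * (((L : ℝ) ^ c.k)⁻¹) ^ 2))
    (fun m => by positivity) htop hface).trans ?_
  have h := faceCount_closed_form h3L hC hP n
  refine le_trans (le_of_eq (Finset.sum_congr rfl fun m _ => by ring)) (h.trans (le_of_eq (by ring)))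

end Carrier

/-! ## §5  `hptu` for the crown's `u₀` from the faces -/

section Hptu

variable {𝔸 : Type*} [CStarAlgebra 𝔸] [Nontrivial 𝔸]
variable {L K : ℕ} {Ω : ℕ → Set (SiteZ d)}

/-- ★★★ **THE POINTWISE MULTISCALE OSCILLATION OF THE CROWN's `u₀` UNDER A DENTED CELL, FROM THE FACES** (the `hptu` binder of ✓p759262 §4 ∕ ✓p760822 with `θ := L⁻¹`): for a dented
record cube `c` (odd `L = 2s+1 ≥ 3`, `d ≥ 1`), `V` unitary in `𝔄_k({Ω_j}, α₀)` with the record's Prop.-1 smallness and `11d²L²α₀ ≤ 1∕6`; a cell `y ∈ Λ′_j`, `1 ≤ j ≤ k`; `h` block-constant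
(`= X`) on the tower under `y`; `um := h⁻¹·u₀` unitary under `y`; and the fine-bond letter `‖c.fixed V (h⁻¹u₀)(x,μ) − 1‖ ≤ δ_F` for the bonds under `y` (the exponential of the crown's
(1.38) log rows, ✓`B8CfgExpBondLetterRec`): for `i < j`, `z` under `y` at depth `j − (i+1)` and `w` under `z`,
`‖u₀(L^{i+1}z)⁻¹·u₀(w) − 1‖ ≤ ω_u·(L⁻¹)^{j−(i+1)}`, `ω_u := 3ds·(9d² + 4ds)·α₀ + 2ds·δ_F·L^{j−1}` — UNIFORM in the cell level (`j ≤ k`).  Route: `c.fixed V um = (c.dprime V)^{um⁻¹}`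
by definition ⇒ per bond `‖um(x)⁻¹um(x+e_μ) − 1‖ ≤ ‖U₀″(b) − 1‖ + ‖F(b) − 1‖` (✓`norm_inv_mul_shift_sub_one_le_of_gaugeAct`) ⇒ segment sums `≤ (3∕2)(9d²+4ds)α₀L^{2n+2−2k} + Lⁿδ_F`
(§4) ⇒ ✓`pointwise_osc_of_adjacent_centres` (`d·s·b(n) ≤ (ω_u∕2)·L^{−(j−(n+1))}` since `n + 1 + j ≤ 2k`) ⇒ `h` drops out under the cell (✓`inv_mul_eq_of_blockConstant`).
[cite: Balaban1985RegularSpaces, (1.135) p.99, (1.133) p.99, (1.29) p.81, Lemma 1 p.79; Balaban1985Averaging, (8) p.18, (166)–(167) p.44, (180)–(182) p.46; Balaban1985Variational, (148)–(152) p.301; Balaban1987RG1, (0.3)–(0.4) pp.252–253] -/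
theorem pointwise_osc_of_faces_precomposed {s : ℕ} (hLs : L = 2 * s + 1) (hs : 1 ≤ s) (hd : 1 ≤ d) (c : CubeB8DZ d L K Ω)
    (V : SiteZ d → Fin d → 𝔸ˣ) (hV : ∀ x κ, V x κ ∈ unitaryUnits 𝔸) {η α₀ : ℝ} (hα : 0 < α₀)
    (hα3 : C0Z d * (α₀ * (L : ℝ) ^ 2) ≤ 1 / 3) (hα2 : 2 * (α₀ * (L : ℝ) ^ 2) ≤ c2' d L) (hsmall : 11 * (d : ℝ) ^ 2 * (L : ℝ) ^ 2 * α₀ ≤ 1 / 6)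
    (hA : InAk L c.k η α₀ Ω V)
    {j : ℕ} (hjk : j ≤ c.k) {y : SiteZ d} (hy : y ∈ c.lamS j)
    (h u₀ : SiteZ d → 𝔸ˣ) {X : 𝔸ˣ} (hconst : ∀ x, UnderZ L j y x → h x = X)
    (hum : ∀ x, UnderZ L j y x → (h⁻¹ * u₀) x ∈ unitaryUnits 𝔸)
    {δF : ℝ} (hδF : 0 ≤ δF)
    (hFb : ∀ x (μ : Fin d), UnderZ L j y x → UnderZ L j y (x + e μ) → ‖((c.fixed V (h⁻¹ * u₀) x μ : 𝔸ˣ) : 𝔸) - 1‖ ≤ δF) :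
    ∀ i, i < j → ∀ z, UnderZ L (j - (i + 1)) y z → ∀ w, UnderZ L (i + 1) z w →
      ‖((((u₀ (((L : ℤ) ^ (i + 1)) • z))⁻¹ * u₀ w : 𝔸ˣ)) : 𝔸) - 1‖ ≤
        (3 * d * s * ((9 * (d : ℝ) ^ 2 + 4 * d * s) * α₀) + 2 * d * s * δF * (L : ℝ) ^ (j - 1)) * ((L : ℝ)⁻¹) ^ (j - (i + 1)) := by
  have hL : Odd L := ⟨s, hLs⟩
  have h3L : 3 ≤ L := by omega
  have hL2 : 2 ≤ L := by omega
  have hL1 : 1 ≤ L := by omega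
  have hL3 : (3 : ℝ) ≤ L := by exact_mod_cast h3L
  have hLpos : (0 : ℝ) < L := by linarith
  have hM1 : 1 ≤ c.M := le_trans (le_trans hL1 c.L_le_ρ) c.ρ_le_M
  have hθ0 : (0 : ℝ) ≤ (L : ℝ)⁻¹ := inv_nonneg.2 hLpos.le
  have hθ : (L : ℝ)⁻¹ ≤ 1 / 2 := by rw [inv_le_comm₀ hLpos (by norm_num)]; linarith
  set um : SiteZ d → 𝔸ˣ := h⁻¹ * u₀ with hum_def
  set W : SiteZ d → Fin d → 𝔸ˣ := c.dprime V with hW_def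
  set Cf : ℝ := (9 * (d : ℝ) ^ 2 + 4 * d * s) * α₀ with hCf
  set P : ℝ := (((L : ℝ) ^ c.k)⁻¹) ^ 2 with hP_def
  have hCf0 : 0 ≤ Cf := by positivity
  have hP0 : 0 ≤ P := by positivity
  -- (1.7) on `□̃` and unitarity of `U₀″`
  have hΩ : ∃ l, l ≤ c.k ∧ c.k ≤ l + 1 ∧ ∀ x, InBox (tlo L (tLo c.a c.ρ) c.k) (thi L (tHi c.a c.M c.ρ) c.k) x → x ∈ Ω l :=
    ⟨c.k - 1, Nat.sub_le _ _, by omega, fun x hx => c.tcube_sub hx⟩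
  have h17 := pdevOn_lt_of_inAk_box hL1 hα hA hΩ
  have hWu : ∀ x (μ : Fin d), W x μ ∈ unitaryUnits 𝔸 := fun x μ =>
    cutFixedZ_mem_unitaryUnits hLs hL2 c.k V hV hα hα3 hα2 (tLo c.a c.ρ) (tHi c.a c.M c.ρ) (tLo_le_tHi hM1) h17 (ctr c.a c.M) x μ
  -- per-bond letters of `um` under `y`: `‖um(x)⁻¹um(x+e_μ) − 1‖ ≤ ‖W(x,μ) − 1‖ + ‖F(x,μ) − 1‖`, `F = W^{um⁻¹} = c.fixed V um` by definition
  have hfine : ∀ x (μ : Fin d), UnderZ L j y x → UnderZ L j y (x + e μ) →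
      ‖((((um x)⁻¹ * um (x + e μ) : 𝔸ˣ)) : 𝔸) - 1‖ ≤ ‖((W x μ : 𝔸ˣ) : 𝔸) - 1‖ + ‖((c.fixed V um x μ : 𝔸ˣ) : 𝔸) - 1‖ := fun x μ hx hx' =>
    norm_inv_mul_shift_sub_one_le_of_gaugeAct um W x μ (hum x hx) (hWu x μ)
  -- the segment sums: faces for `W` (§4) + `Lⁿ·δ_F` for `F`
  have hsum : ∀ n, n < j → ∀ z, UnderZ L (j - (n + 1)) y z → ∀ a (μ : Fin d), UnderZ L 1 z a → UnderZ L 1 z (a + e μ) →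
      ∑ t ∈ Finset.range (L ^ n), (‖((W (((L : ℤ) ^ n) • a + (t : ℤ) • e μ) μ : 𝔸ˣ) : 𝔸) - 1‖ +
          ‖((c.fixed V um (((L : ℤ) ^ n) • a + (t : ℤ) • e μ) μ : 𝔸ˣ) : 𝔸) - 1‖) ≤
        3 / 2 * Cf * P * ((L : ℝ) ^ (n + 1)) ^ 2 + (L : ℝ) ^ n * δF := by
    intro n hn z hz a μ ha ha'
    have hdepth : j - (n + 1) + (n + 1) = j := by omega
    have hsegy : ∀ t : ℕ, t ≤ L ^ n → UnderZ L j y (((L : ℤ) ^ n) • a + (t : ℤ) • e μ) := fun t ht => by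
      have h := underZ_add hL hz (underZ_succ_segment hL ha ha' ht); rwa [hdepth] at h
    have hsucc : ∀ t : ℕ, ((L : ℤ) ^ n) • a + (t : ℤ) • e μ + e μ = ((L : ℤ) ^ n) • a + (((t + 1 : ℕ)) : ℤ) • e μ := fun t => by
      push_cast; rw [add_smul, one_smul, add_assoc]
    rw [Finset.sum_add_distrib]
    refine add_le_add (sum_segment_dprime_le hLs hs hd c V hV hα hα3 hα2 hsmall hA hjk hy hn hz ha ha') ?_
    calc ∑ t ∈ Finset.range (L ^ n), ‖((c.fixed V um (((L : ℤ) ^ n) • a + (t : ℤ) • e μ) μ : 𝔸ˣ) : 𝔸) - 1‖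
        ≤ ∑ _t ∈ Finset.range (L ^ n), δF := Finset.sum_le_sum fun t ht => by
            have ht' := Finset.mem_range.1 ht
            exact hFb _ μ (hsegy t ht'.le) (by rw [hsucc]; exact hsegy (t + 1) ht')
      _ = (L : ℝ) ^ n * δF := by rw [Finset.sum_const, Finset.card_range, nsmul_eq_mul]; push_cast; ring
  -- ✓p755045 with `b(n) := (3/2)·Cf·P·(L^{n+1})² + Lⁿ·δ_F`, `θ := L⁻¹`
  have hadj := adjacent_centre_letters_of_weightedFineBonds hL um j y hum
    (fun x μ => ‖((W x μ : 𝔸ˣ) : 𝔸) - 1‖ + ‖((c.fixed V um x μ : 𝔸ˣ) : 𝔸) - 1‖) hfine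
    (fun n => 3 / 2 * Cf * P * ((L : ℝ) ^ (n + 1)) ^ 2 + (L : ℝ) ^ n * δF) hsum
  have hω0 : 0 ≤ 3 * d * s * Cf + 2 * d * s * δF * (L : ℝ) ^ (j - 1) := by positivity
  have key := pointwise_osc_of_adjacent_centres hLs um j y hum (fun n => 3 / 2 * Cf * P * ((L : ℝ) ^ (n + 1)) ^ 2 + (L : ℝ) ^ n * δF)
    (fun n => by positivity) hθ0 hθ hω0 hadj ?_
  · intro i hi z hz w hw
    have h1 := key i hi z hz w hw
    have hu0 : u₀ = h * um := by rw [hum_def, mul_inv_cancel_left]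
    rw [hu0, inv_mul_eq_of_blockConstant hL h um hconst hi hz hw]
    exact h1
  -- the geometric schedule: `d·s·b(n) ≤ (ω/2)·θ^{j−(n+1)}`
  intro n hn
  have hjk2 : n + 1 + j ≤ 2 * c.k := by omega
  have hLk : (0 : ℝ) < (L : ℝ) ^ (j - (n + 1)) := by positivity
  rw [inv_pow]
  rw [show (3 * d * s * Cf + 2 * d * s * δF * (L : ℝ) ^ (j - 1)) / 2 * ((L : ℝ) ^ (j - (n + 1)))⁻¹ =
      (3 / 2 * d * s * Cf) * ((L : ℝ) ^ (j - (n + 1)))⁻¹ + d * s * δF * ((L : ℝ) ^ (j - 1) * ((L : ℝ) ^ (j - (n + 1)))⁻¹) by ring]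
  rw [show (d : ℝ) * s * (3 / 2 * Cf * P * ((L : ℝ) ^ (n + 1)) ^ 2 + (L : ℝ) ^ n * δF) =
      (3 / 2 * d * s * Cf) * (P * ((L : ℝ) ^ (n + 1)) ^ 2) + d * s * δF * (L : ℝ) ^ n by ring]
  refine add_le_add ?_ ?_
  · -- `P·(L^{n+1})² ≤ L^{−(j−(n+1))}` since `L^{2(n+1)}·L^{j−(n+1)} ≤ L^{2k}`
    refine mul_le_mul_of_nonneg_left ?_ (by positivity)
    rw [hP_def, le_inv_comm₀ (by positivity) hLk]
    · have hpow : ((L : ℝ) ^ (n + 1)) ^ 2 * (L : ℝ) ^ (j - (n + 1)) ≤ ((L : ℝ) ^ c.k) ^ 2 := by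
        rw [← pow_mul, ← pow_add, ← pow_mul]
        exact pow_le_pow_right₀ (by linarith) (by omega)
      have hk0 : (0 : ℝ) < ((L : ℝ) ^ c.k) ^ 2 := by positivity
      rw [inv_pow, ← one_div, ← one_div, le_div_iff₀ (by positivity)]
      calc (L : ℝ) ^ (j - (n + 1)) * (1 / ((L : ℝ) ^ c.k) ^ 2 * ((L : ℝ) ^ (n + 1)) ^ 2)
          = (((L : ℝ) ^ (n + 1)) ^ 2 * (L : ℝ) ^ (j - (n + 1))) / ((L : ℝ) ^ c.k) ^ 2 := by ring
        _ ≤ 1 := by rw [div_le_one hk0]; exact hpow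
  · -- `Lⁿ = L^{j−1}·L^{−(j−(n+1))}`
    have hsplit : (L : ℝ) ^ (j - 1) = (L : ℝ) ^ n * (L : ℝ) ^ (j - (n + 1)) := by rw [← pow_add]; congr 1; omega
    rw [hsplit, mul_assoc ((L : ℝ) ^ n), mul_inv_cancel₀ hLk.ne', mul_one]

end Hptu

end Literature.MathematicalPhysics.QuantumFieldTheory.Balaban1983to89.B8CrownU0PointwiseOscOfFacesRec

end

/-! ## Axiom audit (gate whitelist: `propext`, `Classical.choice`, `Quot.sound`) -/
#print axioms Literature.MathematicalPhysics.QuantumFieldTheory.Balaban1983to89.B8CrownU0PointwiseOscOfFacesRec.sum_segment_le_faceCount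
#print axioms Literature.MathematicalPhysics.QuantumFieldTheory.Balaban1983to89.B8CrownU0PointwiseOscOfFacesRec.pointwise_osc_of_faces_precomposed
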